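import Literature.Topology.FourManifolds.CoupleTwist

/-!
# Sign selection: reflecting boxes so that all planar transition maps preserve orientation

Topic `Literature/Topology/FourManifolds` (support of `stmt-SmoothPoincare4-15190`, structure
conjugacy; step (ε3) of the construction of the sphere diffeomorphism).  Everything here is
**proved**.

Given couple saddle data `Q` on an *oriented* compact `3`-manifold with boundary (index-`1`
boxes, equal bottom and saddle values) and a sphere diffeomorphism `φ` matching the unit core
directions (`hφ0`), reflect the box of `B` at `σ s` exactly when the planar transition map of
the end `true` of `s` reverses orientation (`signFlag`).  For the twisted couple
`Q.twistQB (signFlag …)` **every** planar transition map, at both ends of every saddle, has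
positive Jacobian determinant at `0` (`det_fderiv_tPlanar_twistQB_pos`): at the end `true` by
construction (`det_fderiv_tPlanar_twistQB`), at the end `false` by the orientation law
`det_fderiv_tPlanar_pos_iff` applied to the twisted couple.

## References

* J. Milnor, *Lectures on the h-cobordism theorem* (1965), Def. 3.1 (2), proof of Thm. 3.13.
  [MilnorHCobordism1965]
* M. W. Hirsch, *Differential Topology* (1976), Ch. 4 §4. [HirschDT1976]
-/

open scoped Manifold ContDiff Topology
open Set Function Filter Metric Module

noncomputable section

namespace Literature.Topology.FourManifolds

open Cobordism FourManifolds.Flow TracePolar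

universe u

namespace BasinCouple.SaddleData

attribute [local instance] fact_finrank_euclideanSpace_succ

variable {W : Type u} [TopologicalSpace W] [T2Space W] [SecondCountableTopology W]
  [CompactSpace W] [ChartedSpace (EuclideanHalfSpace (2 + 1)) W] [IsManifold (𝓡∂ (2 + 1)) ∞ W]
  {gA gB : W → ℝ} {ξA ξB : Π x : W, TangentSpace (𝓡∂ (2 + 1)) x} {C : BasinCouple gA gB ξA ξB}
  (Q : C.SaddleData)

/-- Local notation for the model plane and space. -/
local notation "E2" => EuclideanSpace ℝ (Fin 2)
local notation "E3" => EuclideanSpace ℝ (Fin 3)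

/-- The Jacobian determinant at `0` of the planar transition map of the end `b` of `s`. [folklore] -/
def tDet (φ : Metric.sphere (0 : E3) 1 ≃ₘ⟮𝓡 2, 𝓡 2⟯ Metric.sphere (0 : E3) 1) (s : SaddlePt 2 gA) (b : Bool) : ℝ :=
  LinearMap.det ((fderiv ℝ (Q.tPlanar φ s b) 0 : E2 →L[ℝ] E2) : E2 →ₗ[ℝ] E2)

/-- **The reflection flags**: reflect the box of `B` at `s'` iff the planar transition of the end
`true` of `σ⁻¹ s'` reverses orientation. [folklore] -/
def signFlag (φ : Metric.sphere (0 : E3) 1 ≃ₘ⟮𝓡 2, 𝓡 2⟯ Metric.sphere (0 : E3) 1) (s' : SaddlePt 2 gB) : Bool :=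
  decide (Q.tDet φ (Q.σ.symm s') true < 0)

variable {Q} (hkA : ∀ s, (Q.QA.DA s).k = 1) (hkB : ∀ s', (Q.QB.DA s').k = 1)
  (h₀ : gB C.B.p₀ = gA C.A.p₀) (hc : Q.QB.c = Q.QA.c)
  {φ : Metric.sphere (0 : E3) 1 ≃ₘ⟮𝓡 2, 𝓡 2⟯ Metric.sphere (0 : E3) 1}
  (hφ0 : ∀ (s : SaddlePt 2 gA) (b : Bool), (φ (unitVec (Q.QA.coreDir s b)) : E3) = C.A.rad⁻¹ • Q.QB.coreDir (Q.σ s) b)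

/-- Unfolding `tDet`. [folklore] -/
theorem tDet_def (s : SaddlePt 2 gA) (b : Bool) :
    Q.tDet φ s b = LinearMap.det ((fderiv ℝ (Q.tPlanar φ s b) 0 : E2 →L[ℝ] E2) : E2 →ₗ[ℝ] E2) := rfl

include hkA hkB hφ0 in
/-- The planar transition map is differentiable at `0`. [folklore] -/
theorem differentiableAt_tPlanar (s : SaddlePt 2 gA) (b : Bool) : DifferentiableAt ℝ (Q.tPlanar φ s b) 0 := by
  obtain ⟨hy, hmem⟩ := (Q.eventually_coneU_mem_entDom hkA hkB (hφ0 s) b).self_of_nhds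
  exact ((Q.contMDiffAt_tPlanar hkA b hy hmem).contDiffAt).differentiableAt (by simp)

include hφ0 in
/-- The core-direction hypothesis persists for the twisted couple. [folklore] -/
theorem hφ0_twistQB (bf : SaddlePt 2 gB → Bool) (s : SaddlePt 2 gA) (b : Bool) :
    (φ (unitVec ((Q.twistQB bf).QA.coreDir s b)) : E3) = C.A.rad⁻¹ • (Q.twistQB bf).QB.coreDir ((Q.twistQB bf).σ s) b := by
  rw [twistQB_QA, twistQB_σ, coreDir_twistQB]; exact hφ0 s b

include hkA hkB h₀ hc hφ0 in
/-- The planar Jacobians do not vanish. [folklore] -/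
theorem tDet_ne_zero (s : SaddlePt 2 gA) (b : Bool) : Q.tDet φ s b ≠ 0 := by
  intro h
  have h1 := Q.det_fderiv_piMap hkA hkB h₀ hc (hφ0 s) b
  rw [Q.det_fderiv_piMap_eq_mul hkA hkB h₀ hc (hφ0 s) b] at h1
  rw [tDet_def] at h
  rw [h] at h1
  -- the product of three non-zero factors vanishes: contradiction
  have hK : LinearMap.det ((fderiv ℝ ((Q.QB.DA (Q.σ s)).coord ∘ C.B.coneParam) (Q.QB.transition (Q.σ s) (entPoint Q.QB.ε b 0)) :
      E3 →L[ℝ] E3) : E3 →ₗ[ℝ] E3) *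
      LinearMap.det ((fderiv ℝ (Q.QB.transition (Q.σ s)) (entPoint Q.QB.ε b 0) : E3 →L[ℝ] E3) : E3 →ₗ[ℝ] E3) = 1 :=
    Q.QB.det_fderiv_coord_coneParam_mul (hkB _) b (s := Q.σ s)
  have hA : LinearMap.det ((fderiv ℝ ((Q.QA.DA s).coord ∘ C.A.coneParam) (Q.QA.transition s (entPoint Q.QA.ε b 0)) :
      E3 →L[ℝ] E3) : E3 →ₗ[ℝ] E3) *
      LinearMap.det ((fderiv ℝ (Q.QA.transition s) (entPoint Q.QA.ε b 0) : E3 →L[ℝ] E3) : E3 →ₗ[ℝ] E3) = 1 :=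
    Q.QA.det_fderiv_coord_coneParam_mul (hkA s) b (s := s)
  have hJ := coneJac_ne_zero φ (Q.QA.transition_entPoint_zero_mem (hkA s) b).1.1
  rcases mul_eq_zero.1 h1 with h2 | h2
  · rcases mul_eq_zero.1 h2 with h3 | h3
    · rw [h3, zero_mul] at hK; exact zero_ne_one hK
    · exact hJ h3
  · rw [h2, mul_zero] at hA; exact zero_ne_one hA

include hkA hkB h₀ hc hφ0 in
/-- **After the sign selection every planar transition map has positive Jacobian at `0`.** [cite: MilnorHCobordism1965, Def. 3.1 (2), proof of Thm. 3.13] [cite: HirschDT1976, Ch. 4 §4] -/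
theorem tDet_twistQB_pos (o : SmoothOrientation (𝓡∂ (2 + 1)) W) (s : SaddlePt 2 gA) (b : Bool) :
    0 < (Q.twistQB (Q.signFlag φ)).tDet φ s b := by
  -- the end `true`
  have htrue : ∀ s : SaddlePt 2 gA, 0 < (Q.twistQB (Q.signFlag φ)).tDet φ s true := by
    intro s
    rw [tDet_def, Q.det_fderiv_tPlanar_twistQB hkA hkB (hφ0 s) true (Q.differentiableAt_tPlanar hkA hkB hφ0 s true)]
    have hne : Q.tDet φ s true ≠ 0 := Q.tDet_ne_zero hkA hkB h₀ hc hφ0 s true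
    rw [← tDet_def]
    unfold signFlag
    rw [Equiv.symm_apply_apply]
    have hbt : boolSign (!true) = -1 := by simp [boolSign]
    have hbf : boolSign (!false) = 1 := by simp [boolSign]
    by_cases hneg : Q.tDet φ s true < 0
    · rw [decide_eq_true hneg, hbt]; nlinarith
    · rw [decide_eq_false hneg, hbf, one_mul]
      rcases hne.lt_or_gt with h | h
      · exact absurd h hneg
      · exact h
  cases b
  · -- the end `false`, by the orientation law for the twisted couple
    have hlaw := det_fderiv_tPlanar_pos_iff (Q := Q.twistQB (Q.signFlag φ)) (s := s) hkA hkB h₀ hc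
      (Q.hφ0_twistQB hφ0 (Q.signFlag φ) s) o
    exact hlaw.1 (htrue s)
  · exact htrue s

end BasinCouple.SaddleData

end Literature.Topology.FourManifolds
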